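import Mathlib
import HarnessLib
import Summits.AtomisticToContinuum.FouriersLaw.Theses.StaticAbelianSqueeze
import Summits.AtomisticToContinuum.FouriersLaw.Theorems.LatticeLandauDampingAbelThermodynamicLimitAutocorrIntegrableOn

/-!
# Reduction of TGK3 (`stub_truncatedGKQuasiAdditive`, line `Sketch`, crux stmt-AtomisticToContinuum-13416) to an
# EARLY three-chain face and a post-crossing TAIL face
(`--supports` file proving the registered glue stub `stub_truncatedGKQuasiAdditiveOfEarly3OfTailsRate`; closes nothing; written by a
wave-4 stub-worker of the lead c1; EARLY3 and TAILSRATE are the registered physical stubs `stub_early3Cancellation`,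
`stub_postCrossingTailsRate` of the skeleton rev 6)

For the OPEN pinned anharmonic chain `pinnedChain ω₂ lam β γ` (all `> 0`), both baths at `T > 0`, write
`c_M(t) = ∫ J·(P_t J) dμ_{M,T}` (`J = Σ_i j_i`, equilibrium total-current autocorrelation of the `M`-chain) and
`d_N = c_N − c_{⌊N/2⌋} − c_{N−⌊N/2⌋}` (the three-chain halving difference).  TGK3 (registered physical stub
`stub_truncatedGKQuasiAdditive`, `ν`-free form of composition B) is
  `∃ K, δ ∈ (0,1), N₁ ∀ N ≥ 2N₁ ∀ ξ ≥ 0, |∫_{(ξ,∞)} d_N| ≤ K N^{1−δ}`.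

**Theorem (`stub_truncatedGKQuasiAdditiveOfEarly3OfTailsRate`).**  TGK3 ⇐ EARLY3 ∧ TAILSRATE, where (same `let c` as the stub)
* EARLY3 (the pre-crossing face; junction-minus-two-contacts with bounded RUNNING signed integrals):
  `∃ c₀ > 0, K, δ ∈ (0,1), N₁ ∀ N ≥ 2N₁ ∀ ξ ∈ [0, c₀⌊N/2⌋], |∫_{(ξ, c₀⌊N/2⌋]} d_N| ≤ K N^{1−δ}` — signed and uniform in the
  lower endpoint `ξ`, so that the `N`-free junction function may oscillate (only its running integrals must stay `O(N^{1−δ})`);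
  physics: before the common crossing time `c₀⌊N/2⌋` the extensive bulk parts `(M−1)·C(t)` of `c_N, c_{⌊N/2⌋}, c_{⌈N/2⌉}` cancel
  EXACTLY in `d_N`, leaving one junction correction minus two contact corrections;
* TAILSRATE (the post-crossing face = K1 `stub_postCrossingTails` with a power rate, every slope):
  `∀ c₀ > 0 ∃ K, δ ∈ (0,1), N₀ ∀ N ≥ N₀ ∀ ξ ≥ c₀N, |∫_{(ξ,∞)} c_N| ≤ K N^{1−δ}` (fluctuating hydrodynamics predicts `δ = 1/2`).

Proof (pure bookkeeping): put `τ = c₀⌊N/2⌋`.  For `0 ≤ ξ ≤ τ` split `∫_{(ξ,∞)} d_N = ∫_{(ξ,τ]} d_N + ∫_{(τ,∞)} d_N` (all three `c_M` are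
integrable on `(0,∞)` at fixed `M`: `stub_autocorrIntegrableOn`, p144688); the first piece is EARLY3, the second is three signed tails
at `τ ≥ (c₀/3)·M` for each of the three sizes `M ∈ {N, ⌊N/2⌋, ⌈N/2⌉}` (`N ≤ 3⌊N/2⌋` for `N ≥ 2`), each `≤ K_T M^{1−δ_T} ≤ K_T N^{1−δ}`
by TAILSRATE at slope `c₀/3` with `δ = min δ_E δ_T`.  For `ξ > τ` only the three tails occur.  Constant `max K_E 0 + 3·max K_T 0`,
threshold `N ≥ 2·max(N_E, N_T, 1)`.

Blockers (why neither face is in the tree; nearest landed decls):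
* EARLY3 needs a TWO-dynamics comparison of the open `N`-chain with its two open halves up to times `≍ N` (linear horizon).  Every
  landed matching engine has an `N`-INDEPENDENT horizon: the fixed-time finite-vs-infinite matching family (p127009) and the
  fixed-horizon anchored cone `stub_uniformAnchoredCorrelationTails` (p119825, onset `≍ τ²`); the Buttà–Marchioro almost-linear cone
  is landed only as a propagation bound, not as a current-autocorrelation splice; no one-contact / junction correlation object exists
  (`JunctionLocality*` files are frequency-0 resistance bookkeeping: `junctionDichotomy_proof`, `DyadicIncrement.doublingDefect_eq`
  — "no engine for the increment bound exists for the deterministic chain").  Its face `ξ = 0` alone is GK quasi-additivity of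
  `(N−1)T²D_N` with a power defect (⇒ `D_N → κ` at rate `N^{−δ}`, census S2 class) by `StaticAbelianSqueeze.kuboAbelIdentity_holds`.
* TAILSRATE is K1 with a rate: signed post-crossing tails of ONE open chain, uniformly in `N` — an `N`-uniform memory-loss statement at
  times `≍ N … N²` (census D9 "cone-entry window"); nearest landed: K1 ⇐ the twin's ST (p153215), K1 ⇐ TGK3
  (`stub_postCrossingTailsOfTruncatedGK`), fixed-`N` tails → 0 (`tendsto_setIntegral_Ioi_atTop` + p144688, no uniformity);
  corrector/resolvent forms die on `‖(−L_N)⁻¹J‖² ≳ N²` (census T7), the energy-centre identity costs `×N` (D6).  False at the harmonic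
  corner `lam = β = 0` (`Negative/HarmonicCornerTwoScale`, p148790).
No named fact is used; nothing here closes the item.
-/

noncomputable section

namespace Summit.AtomisticToContinuum.FouriersLaw.Theorems.UniformAbelianRegularity.ZeroMeanDyadicSplice

open MeasureTheory Set Filter Topology
open Summit.AtomisticToContinuum.FouriersLaw.Theorems.AbelThermodynamicLimit.SeriesLawAtEveryLaplaceFrequency
  (stub_autocorrIntegrableOn)

/-- Power bookkeeping of the halving tree: for `1 ≤ M ≤ N`, `δ ≤ δ'` and `δ ≤ 1`, `M^{1−δ'} ≤ N^{1−δ}`. [folklore] -/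
theorem rpow_oneSub_le_of_size_le {M N δ δ' : ℝ} (hM : 1 ≤ M) (hMN : M ≤ N) (hδ : δ ≤ δ') (hδ1 : δ ≤ 1) :
    M ^ (1 - δ') ≤ N ^ (1 - δ) :=
  (Real.rpow_le_rpow_of_exponent_le hM (by linarith)).trans
    (Real.rpow_le_rpow (by linarith) hMN (by linarith))

/-- Splitting a tail integral at an intermediate point: `∫_{(ξ,∞)} f = ∫_{(ξ,τ]} f + ∫_{(τ,∞)} f` for `ξ ≤ τ` and `f`
integrable on `(ξ,∞)`. [folklore] -/
theorem setIntegral_Ioi_eq_Ioc_add_Ioi {f : ℝ → ℝ} {ξ τ : ℝ} (hξτ : ξ ≤ τ) (hf : IntegrableOn f (Ioi ξ)) :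
    ∫ s in Ioi ξ, f s = (∫ s in Ioc ξ τ, f s) + ∫ s in Ioi τ, f s := by
  rw [← setIntegral_union (Ioc_disjoint_Ioi le_rfl) measurableSet_Ioi (hf.mono_set Ioc_subset_Ioi_self)
      (hf.mono_set (Ioi_subset_Ioi hξτ)), Ioc_union_Ioi_eq_Ioi hξτ]

/-- **Registered glue stub `stub_truncatedGKQuasiAdditiveOfEarly3OfTailsRate` of line `Sketch` (crux stmt-AtomisticToContinuum-13416): TGK3 ⇐ EARLY3 ∧ TAILSRATE.**
Truncated Green–Kubo halving quasi-additivity, uniformly in the truncation point `ξ ≥ 0`, follows from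
(EARLY3) the signed, `ξ`-uniform bound on `∫_{(ξ, c₀⌊N/2⌋]} (c_N − c_{⌊N/2⌋} − c_{N−⌊N/2⌋})` before the common crossing time and
(TAILSRATE) the power-rate post-crossing signed tails `|∫_{(ξ,∞)} c_N| ≤ K N^{1−δ}` (`ξ ≥ c₀N`, every slope `c₀ > 0`):
split at `τ = c₀⌊N/2⌋`, three tails at slope `c₀/3` (`N ≤ 3⌊N/2⌋`), fixed-`M` integrability `stub_autocorrIntegrableOn` (p144688).
The conclusion is the registered signature VERBATIM. [folklore] -/
theorem stub_truncatedGKQuasiAdditiveOfEarly3OfTailsRate :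
    (∀ ω₂ lam β γ : ℝ, 0 < ω₂ → 0 < lam → 0 < β → 0 < γ → ∀ T : ℝ, 0 < T → ∃ (c₀ K δ : ℝ) (N₁ : ℕ), 0 < c₀ ∧ 0 < δ ∧ δ < 1 ∧ ∀ N : ℕ, 2 * N₁ ≤ N → ∀ ξ : ℝ, 0 ≤ ξ → ξ ≤ c₀ * ((N / 2 : ℕ) : ℝ) → let c : ℕ → ℝ → ℝ := fun M t => ∫ z, (∑ i : Fin M, (Literature.MathematicalPhysics.KineticTheory.HeatConduction.pinnedChain ω₂ lam β γ).bondCurrent M i z) * (∫ y, (∑ i : Fin M, (Literature.MathematicalPhysics.KineticTheory.HeatConduction.pinnedChain ω₂ lam β γ).bondCurrent M i y) ∂((Literature.MathematicalPhysics.KineticTheory.HeatConduction.pinnedChain ω₂ lam β γ).transitionKernel M T T t.toNNReal z)) ∂((Literature.MathematicalPhysics.KineticTheory.HeatConduction.pinnedChain ω₂ lam β γ).gibbsMeasure M T); |∫ s in Set.Ioc ξ (c₀ * ((N / 2 : ℕ) : ℝ)), (c N s - c (N / 2) s - c (N - N / 2) s)| ≤ K * (N:ℝ) ^ (1 - δ))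 →
    (∀ ω₂ lam β γ : ℝ, 0 < ω₂ → 0 < lam → 0 < β → 0 < γ → ∀ T : ℝ, 0 < T → ∀ c₀ : ℝ, 0 < c₀ → ∃ (K δ : ℝ) (N₀ : ℕ), 0 < δ ∧ δ < 1 ∧ ∀ N : ℕ, N₀ ≤ N → ∀ ξ : ℝ, c₀ * N ≤ ξ → let c : ℕ → ℝ → ℝ := fun M t => ∫ z, (∑ i : Fin M, (Literature.MathematicalPhysics.KineticTheory.HeatConduction.pinnedChain ω₂ lam β γ).bondCurrent M i z) * (∫ y, (∑ i : Fin M, (Literature.MathematicalPhysics.KineticTheory.HeatConduction.pinnedChain ω₂ lam β γ).bondCurrent M i y) ∂((Literature.MathematicalPhysics.KineticTheory.HeatConduction.pinnedChain ω₂ lam β γ).transitionKernel M T T t.toNNReal z)) ∂((Literature.MathematicalPhysics.KineticTheory.HeatConduction.pinnedChain ω₂ lam β γ).gibbsMeasure M T); |∫ s in Set.Ioi ξ, c N s| ≤ K * (N:ℝ) ^ (1 - δ)) →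
    ∀ ω₂ lam β γ : ℝ, 0 < ω₂ → 0 < lam → 0 < β → 0 < γ → ∀ T : ℝ, 0 < T → ∃ (K δ : ℝ) (N₁ : ℕ), 0 < δ ∧ δ < 1 ∧ ∀ N : ℕ, 2 * N₁ ≤ N → ∀ ξ : ℝ, 0 ≤ ξ → let c : ℕ → ℝ → ℝ := fun M t => ∫ z, (∑ i : Fin M, (Literature.MathematicalPhysics.KineticTheory.HeatConduction.pinnedChain ω₂ lam β γ).bondCurrent M i z) * (∫ y, (∑ i : Fin M, (Literature.MathematicalPhysics.KineticTheory.HeatConduction.pinnedChain ω₂ lam β γ).bondCurrent M i y) ∂((Literature.MathematicalPhysics.KineticTheory.HeatConduction.pinnedChain ω₂ lam β γ).transitionKernel M T T t.toNNReal z)) ∂((Literature.MathematicalPhysics.KineticTheory.HeatConduction.pinnedChain ω₂ lam β γ).gibbsMeasure M T); |∫ s in Set.Ioi ξ, (c N s - c (N / 2) s - c (N - N / 2) s)| ≤ K * (N:ℝ) ^ (1 - δ) := by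
  intro hE3 hTR ω₂ lam β γ hω hl hβ hγ T hT
  obtain ⟨c₀, KE, δE, NE, hc₀, hδE, hδE1, hQE⟩ := hE3 ω₂ lam β γ hω hl hβ hγ T hT
  obtain ⟨KT, δT, NT, hδT, -, hQT⟩ := hTR ω₂ lam β γ hω hl hβ hγ T hT (c₀ / 3) (by positivity)
  refine ⟨max KE 0 + 3 * max KT 0, min δE δT, max (max NE NT) 1, lt_min hδE hδT,
    (min_le_left _ _).trans_lt hδE1, ?_⟩
  intro N hN ξ hξ c
  -- integer bookkeeping on the three sizes `N`, `⌊N/2⌋`, `N − ⌊N/2⌋`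
  have hmaxE : NE ≤ max (max NE NT) 1 := (le_max_left _ _).trans (le_max_left _ _)
  have hmaxT : NT ≤ max (max NE NT) 1 := (le_max_right _ _).trans (le_max_left _ _)
  have hmax1 : 1 ≤ max (max NE NT) 1 := le_max_right _ _
  have hNE : 2 * NE ≤ N := by omega
  have hNT : 2 * NT ≤ N := by omega
  have hN2 : 2 ≤ N := by omega
  have h1a : 1 ≤ N / 2 := by omega
  have h1b : 1 ≤ N - N / 2 := by omega
  have hTa : NT ≤ N / 2 := by omega
  have hTb : NT ≤ N - N / 2 := by omega
  have hTN : NT ≤ N := by omega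
  have h3N : (N:ℝ) ≤ 3 * ((N / 2 : ℕ) : ℝ) := by exact_mod_cast (by omega : N ≤ 3 * (N / 2))
  have h3b : ((N - N / 2 : ℕ) : ℝ) ≤ 3 * ((N / 2 : ℕ) : ℝ) := by
    exact_mod_cast (by omega : N - N / 2 ≤ 3 * (N / 2))
  have hhalf0 : (0:ℝ) ≤ ((N / 2 : ℕ) : ℝ) := Nat.cast_nonneg _
  have hτ0 : 0 ≤ c₀ * ((N / 2 : ℕ) : ℝ) := mul_nonneg hc₀.le hhalf0
  -- the three slope facts `(c₀/3)·M ≤ τ = c₀⌊N/2⌋`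
  have hsN : c₀ / 3 * (N:ℝ) ≤ c₀ * ((N / 2 : ℕ) : ℝ) := by
    calc c₀ / 3 * (N:ℝ) ≤ c₀ / 3 * (3 * ((N / 2 : ℕ) : ℝ)) := mul_le_mul_of_nonneg_left h3N (by positivity)
      _ = c₀ * ((N / 2 : ℕ) : ℝ) := by ring
  have hsa : c₀ / 3 * ((N / 2 : ℕ) : ℝ) ≤ c₀ * ((N / 2 : ℕ) : ℝ) := by nlinarith
  have hsb : c₀ / 3 * ((N - N / 2 : ℕ) : ℝ) ≤ c₀ * ((N / 2 : ℕ) : ℝ) := by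
    calc c₀ / 3 * ((N - N / 2 : ℕ) : ℝ) ≤ c₀ / 3 * (3 * ((N / 2 : ℕ) : ℝ)) :=
          mul_le_mul_of_nonneg_left h3b (by positivity)
      _ = c₀ * ((N / 2 : ℕ) : ℝ) := by ring
  -- real bookkeeping on constants and powers
  have hKT0 : 0 ≤ max KT 0 := le_max_right _ _
  have hKE0 : 0 ≤ max KE 0 := le_max_right _ _
  have hNr1 : (1:ℝ) ≤ N := by exact_mod_cast le_trans (by norm_num) hN2
  have hδ1 : min δE δT ≤ 1 := (min_le_left _ _).trans hδE1.le
  have hpow0 : 0 ≤ (N:ℝ) ^ (1 - min δE δT) := Real.rpow_nonneg (Nat.cast_nonneg _) _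
  -- fixed-`M` integrability of `c M` on `(0, ∞)` (landed, p144688)
  have hint : ∀ M : ℕ, IntegrableOn (c M) (Ioi 0) := fun M =>
    stub_autocorrIntegrableOn ω₂ lam β γ hω hl hβ hγ T hT M
  -- one post-crossing tail of a chain of size `M ∈ [1, N]`, `M ≥ N_T`, beyond `(c₀/3)·M`
  have htailM : ∀ M : ℕ, 1 ≤ M → M ≤ N → NT ≤ M → ∀ ξ' : ℝ, c₀ / 3 * (M:ℝ) ≤ ξ' →
      |∫ s in Ioi ξ', c M s| ≤ max KT 0 * (N:ℝ) ^ (1 - min δE δT) := by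
    intro M h1M hMN hNTM ξ' hξ'
    have h : |∫ s in Ioi ξ', c M s| ≤ KT * (M:ℝ) ^ (1 - δT) := hQT M hNTM ξ' hξ'
    have hM1 : (1:ℝ) ≤ M := by exact_mod_cast h1M
    have hMN' : (M:ℝ) ≤ N := by exact_mod_cast hMN
    calc |∫ s in Ioi ξ', c M s| ≤ KT * (M:ℝ) ^ (1 - δT) := h
      _ ≤ max KT 0 * (M:ℝ) ^ (1 - δT) :=
          mul_le_mul_of_nonneg_right (le_max_left _ _) (Real.rpow_nonneg (Nat.cast_nonneg _) _)
      _ ≤ max KT 0 * (N:ℝ) ^ (1 - min δE δT) :=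
          mul_le_mul_of_nonneg_left (rpow_oneSub_le_of_size_le hM1 hMN' (min_le_right _ _) hδ1) hKT0
  -- the three post-crossing tails of `d_N` beyond any `ξ' ≥ τ`
  have htail : ∀ ξ' : ℝ, c₀ * ((N / 2 : ℕ) : ℝ) ≤ ξ' →
      |∫ s in Ioi ξ', (c N s - c (N / 2) s - c (N - N / 2) s)| ≤
        3 * max KT 0 * (N:ℝ) ^ (1 - min δE δT) := by
    intro ξ' hξ'
    have hξ'0 : 0 ≤ ξ' := hτ0.trans hξ'
    have hi : ∀ M : ℕ, IntegrableOn (c M) (Ioi ξ') := fun M => (hint M).mono_set (Ioi_subset_Ioi hξ'0)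
    have hsplit : (∫ s in Ioi ξ', (c N s - c (N / 2) s - c (N - N / 2) s)) =
        (∫ s in Ioi ξ', c N s) - (∫ s in Ioi ξ', c (N / 2) s) - ∫ s in Ioi ξ', c (N - N / 2) s := by
      have i1 : Integrable (fun s => c N s - c (N / 2) s) (volume.restrict (Ioi ξ')) := (hi N).sub (hi (N / 2))
      rw [integral_sub i1 (hi (N - N / 2)), integral_sub (hi N) (hi (N / 2))]
    rw [hsplit]
    have hA := htailM N (le_trans (by norm_num) hN2) le_rfl hTN ξ' (hsN.trans hξ')
    have hB := htailM (N / 2) h1a (Nat.div_le_self _ _) hTa ξ' (hsa.trans hξ')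
    have hC := htailM (N - N / 2) h1b (Nat.sub_le _ _) hTb ξ' (hsb.trans hξ')
    calc |(∫ s in Ioi ξ', c N s) - (∫ s in Ioi ξ', c (N / 2) s) - ∫ s in Ioi ξ', c (N - N / 2) s|
        ≤ |∫ s in Ioi ξ', c N s| + |∫ s in Ioi ξ', c (N / 2) s| + |∫ s in Ioi ξ', c (N - N / 2) s| :=
          ((abs_sub _ _).trans (add_le_add (abs_sub _ _) le_rfl))
      _ ≤ max KT 0 * (N:ℝ) ^ (1 - min δE δT) + max KT 0 * (N:ℝ) ^ (1 - min δE δT) +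
            max KT 0 * (N:ℝ) ^ (1 - min δE δT) := add_le_add (add_le_add hA hB) hC
      _ = 3 * max KT 0 * (N:ℝ) ^ (1 - min δE δT) := by ring
  -- early/late split at `τ = c₀⌊N/2⌋` when `ξ ≤ τ`; three tails only when `ξ > τ`
  rcases le_or_gt ξ (c₀ * ((N / 2 : ℕ) : ℝ)) with hle | hlt
  · have hdint : IntegrableOn (fun s => c N s - c (N / 2) s - c (N - N / 2) s) (Ioi ξ) :=
      (((hint N).sub (hint (N / 2))).sub (hint (N - N / 2))).mono_set (Ioi_subset_Ioi hξ)
    rw [setIntegral_Ioi_eq_Ioc_add_Ioi hle hdint]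
    have h1 : |∫ s in Ioc ξ (c₀ * ((N / 2 : ℕ) : ℝ)), (c N s - c (N / 2) s - c (N - N / 2) s)| ≤
        KE * (N:ℝ) ^ (1 - δE) := hQE N hNE ξ hξ hle
    have h2 := htail (c₀ * ((N / 2 : ℕ) : ℝ)) le_rfl
    have hpowE : (N:ℝ) ^ (1 - δE) ≤ (N:ℝ) ^ (1 - min δE δT) :=
      rpow_oneSub_le_of_size_le hNr1 le_rfl (min_le_left _ _) hδ1
    have h1' : KE * (N:ℝ) ^ (1 - δE) ≤ max KE 0 * (N:ℝ) ^ (1 - min δE δT) :=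
      (mul_le_mul_of_nonneg_right (le_max_left _ _) (Real.rpow_nonneg (Nat.cast_nonneg _) _)).trans
        (mul_le_mul_of_nonneg_left hpowE hKE0)
    calc |(∫ s in Ioc ξ (c₀ * ((N / 2 : ℕ) : ℝ)), (c N s - c (N / 2) s - c (N - N / 2) s)) +
            ∫ s in Ioi (c₀ * ((N / 2 : ℕ) : ℝ)), (c N s - c (N / 2) s - c (N - N / 2) s)|
        ≤ |∫ s in Ioc ξ (c₀ * ((N / 2 : ℕ) : ℝ)), (c N s - c (N / 2) s - c (N - N / 2) s)| +
            |∫ s in Ioi (c₀ * ((N / 2 : ℕ) : ℝ)), (c N s - c (N / 2) s - c (N - N / 2) s)| := abs_add_le _ _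
      _ ≤ max KE 0 * (N:ℝ) ^ (1 - min δE δT) + 3 * max KT 0 * (N:ℝ) ^ (1 - min δE δT) :=
          add_le_add (h1.trans h1') h2
      _ = (max KE 0 + 3 * max KT 0) * (N:ℝ) ^ (1 - min δE δT) := by ring
  · have h2 := htail ξ hlt.le
    calc |∫ s in Ioi ξ, (c N s - c (N / 2) s - c (N - N / 2) s)|
        ≤ 3 * max KT 0 * (N:ℝ) ^ (1 - min δE δT) := h2
      _ ≤ max KE 0 * (N:ℝ) ^ (1 - min δE δT) + 3 * max KT 0 * (N:ℝ) ^ (1 - min δE δT) :=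
          le_add_of_nonneg_left (mul_nonneg hKE0 hpow0)
      _ = (max KE 0 + 3 * max KT 0) * (N:ℝ) ^ (1 - min δE δT) := by ring

end Summit.AtomisticToContinuum.FouriersLaw.Theorems.UniformAbelianRegularity.ZeroMeanDyadicSplice

end
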